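import Summits.QuantumFields.BalabanUV.T4Continuum.Support.KingPairingPlantedLaw
import Summits.QuantumFields.BalabanUV.Beta.GAN24.SoftColumnVertexRate

/-!
# `BalabanUV.Beta.GAN24.SoftColumnCovarianceChain` — binder row G-an2-4 ∕ (CONV-C), route R7 «TWO CURRENCIES», S4 EXECUTED ON TYPED
# BAŁABAN OBJECTS WITH AN OPERATOR SLOT, UNCONDITIONALLY: the chain «leg · fine covariance · leg» `W^𝒢_k(p,r) = ⟨M̃_ke_p, 𝒢_k M̃_ke_r⟩`
# of NE2-P1's `U = 1` tower is entrywise Cauchy at rate `θ₁ = L⁻¹` — legs in `ℓ²` (`opNorm_Mtil_succ_sub_le`), the operator slot in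
# OPERATOR norm through KING's PAIRING (`KingPairingPlantedLaw.opNorm_calG_sub_planted_le` = R7's (ρ1), ALREADY IN THE TREE)

NOT IN PRINT; OUR PROOF ATTEMPT (prover part P3 of row G-an2-4, fibre∕strip («Woodbury») lineage, gen 25; CRUX TEAM (2), ruling «YM
REDIRECT TOWARDS THE SUMMIT», 2026-08-21: «work the best two candidate routes of record»).  HONEST DEPENDENCY (cell records, verbatim):
«continuum YM on T⁴ ⇐ BetaPertH ∧ nine spine estimates (0/9 proved); BetaPertH ⇐ (D1) ∧ (D4) ∧ CAP+tail; G-an2-4 gates asym, D1 and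
NE2/3/4.»  HONEST FRAMING (cell contract, verbatim): «discharging `BetaPertH` makes Bałaban's UV stability UNCONDITIONAL — a real
constructive-QFT result; it is NOT the continuum limit and NOT the Clay problem.»  ABSOLUTE RULE: nothing printed is a hypothesis; no
`def … : Prop`, no sorry; [folklore] algebra over TREE objects BY NAME.

## Located (for `HOME/beta/ROUTES-GAN24.md` v6 §2 R7 S3 (ρ1) «TO PROVE (S): the p′ = 0 fibre and the assembly over fibres»)

R7's (ρ1) — the fine × fine covariance ONE-STEP LAW IN OPERATOR NORM against a prolongation `ι` — IS A TREE THEOREM for `ι` = King's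
isometric staircase: NE2-P1 gen 9's `KingPairingPlantedLaw.opNorm_calG_sub_planted_le` `‖𝒢^{(η/R)} − J_R𝒢^{(η)}J_Rᴴ‖ ≤ CJ(d,a)·η`
(block Poincaré + the King–Q law; no `p′ = 0` fibre, no assembly over fibres needed).  §1 records its SANDWICHED form along the tower,
**`opNorm_sandwich_calG_sub_le`** `‖J_kᴴ𝒢_{k+1}J_k − 𝒢_k‖ ≤ CJ·L^{−k}` (`J_kᴴJ_k = 1`) — the form the Leibniz sum consumes (the operator
slot is differenced AFTER moving the staircases onto it: `⟨Jℓ, 𝒢′Jℓ′⟩ = ⟨ℓ, (Jᴴ𝒢′J)ℓ′⟩`).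

## What is proved (R7-S4 for the operator-slot chain; all `U = 1`, every torus `M`, every `L ≥ 1`, `d`, `a > 0`; NO letter)

 * §1 `opNorm_sandwich_calG_sub_le`; `norm_conjTranspose_mul_mul_apply_le` (`‖(AᴴTB) p r‖ ≤ ‖A‖‖T‖‖B‖`);
 * §2 the algebra **`covChain_succ_sub_eq`**: `M̃′ᴴ𝒢′M̃′ − M̃ᴴ𝒢M̃ = M̃′ᴴ𝒢′(M̃′ − JM̃) + (M̃′ − JM̃)ᴴ𝒢′(JM̃) + M̃ᴴ(Jᴴ𝒢′J − 𝒢)M̃` — three slots,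
   «replace one by one every factor», the operator slot differenced in the SANDWICHED form;
 * §3 **`norm_covChain_succ_sub_le`**: for all unit sites∕components `p r` and every `k`,
   `‖W^𝒢_{k+1}(p,r) − W^𝒢_k(p,r)‖ ≤ (2·(a·Cst)·Cst·(a·CQH) + (a·Cst)²·CJ)·L^{−k}` with `W^𝒢_k := M̃_kᴴ·𝒢_k·M̃_k` (entries
   `⟨M̃_ke_p, 𝒢_kM̃_ke_r⟩` = the physical `⟨u_p, 𝒢_k u_r⟩_{L²(T_η)}` of the soft legs `u = √(n_k^d)·M̃e`) — UNCONDITIONAL SupRate `θ₁ = L⁻¹`: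
   legs in `ℓ²` (`opNorm_Mtil_succ_sub_le`, `‖M̃‖ ≤ a·Cst`), operator in operator norm (`‖𝒢‖ ≤ Cst`, §1), entries by `ChainLeibniz.norm_entry_le`.

HONEST SCOPE.  A MODEL chain on typed objects (the SHAPE «leg · 𝒢(1) · leg» of the u-sector's chains with one fine covariance between two
unit-sourced legs — e.g. the propagator line of the second-order response — WITHOUT the local vertices; no claim that it IS a Table-T row:
S1∕S7 are an2's ∕ p1's); SOFT legs; `U = 1`; order-(−2) operator slot only ((ρ2)'s order-zero `∇𝒢∇*` slots need the H¹-tested rate, NOT here).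
Supplier work on the route of record; zero on the D1 grid; NOT (CONV-C) (a list), NOT (ρ2)(ρ3), NEVER «G-an2-4 closed», NOT D1, NOT BetaPertH,
NOT continuum, NOT Clay.  Locators (text only): [Balaban1984PropagatorsI] (1.83) p. 31, Prop. 1.1 (1.89) p. 33; [King1986] Prop. 3.8 p. 664–665,
Lemma 4.5 (4.38) p. 674.  Provenance: prover-b2b-balaban-gan24-p3-g25-0 (unit `b2b-balaban-gan24-p3`, gen 25), 2026-08-21.
-/

noncomputable section

open scoped BigOperators ComplexConjugate Matrix Matrix.Norms.L2Operator
open Finset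

namespace Summit.QuantumFields.BalabanUV.Beta.GAN24.SoftColumnCovarianceChain

open Literature.MathematicalPhysics.QuantumFieldTheory.Balaban1983to89.B5Prop11Plancherel
open Literature.MathematicalPhysics.QuantumFieldTheory.Balaban1983to89.B5Prop11Lower (nsq nsq_nonneg)
open Literature.MathematicalPhysics.QuantumFieldTheory.Balaban1983to89.B5G183RateUnitTower (lev lev_neZero)
open Summit.QuantumFields.BalabanUV.T4Continuum.BalabanAveragedTowerUnit (idx lev_succ' one_le_lev' cast_lev' calGlev)
open Summit.QuantumFields.BalabanUV.T4Continuum.BalabanMinimizerLaw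
open Summit.QuantumFields.BalabanUV.T4Continuum.KingPairingPlantedLaw (CJ CJ_nonneg opNorm_calG_sub_planted_le)
open Summit.QuantumFields.BalabanUV.Beta.GAN24.ChainLeibniz
open Summit.QuantumFields.BalabanUV.Beta.GAN24.SoftColumnVertexRate (opNorm_Mtil_le)

variable {d : ℕ} (L : ℕ) [NeZero L] (M : Fin d → ℕ) [hM : ∀ μ, NeZero (M μ)] (a : ℝ) (ha : 0 < a)

/-! ## §1 The operator slot: R7's (ρ1) in the SANDWICHED form along the tower -/

/-- the level-`(k+1)` free covariance read at the syntactic successor level `L·n_k` (identity transport; the index types are definitionally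
equal). [folklore] -/
def calGsucc (k : ℕ) : Matrix (Tor (fine (L * lev L k) M) × Fin d) (Tor (fine (L * lev L k) M) × Fin d) ℂ := calGlev L M a ha (k + 1)

/-- `‖𝒢_{k+1}‖ ≤ Cst` at the successor level. [folklore] -/
theorem opNorm_calGsucc_le (k : ℕ) : ‖calGsucc L M a ha k‖ ≤ Cst d a := opNorm_calG_le (L * lev L k) (one_le_lev' L (k + 1)) M a ha

/-- **R7's (ρ1), SANDWICHED, ALONG THE TOWER**: `‖J_kᴴ·𝒢_{k+1}·J_k − 𝒢_k‖ ≤ CJ(d,a)·L^{−k}` — from NE2-P1's planted law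
`‖𝒢_{k+1} − J_k𝒢_kJ_kᴴ‖ ≤ CJ·L^{−k}` (`KingPairingPlantedLaw.opNorm_calG_sub_planted_le`) and `J_kᴴJ_k = 1`, `‖J_k‖ ≤ 1`. [folklore] -/
theorem opNorm_sandwich_calG_sub_le (k : ℕ) :
    ‖(Jpc L M k)ᴴ * calGsucc L M a ha k * Jpc L M k - calGlev L M a ha k‖ ≤ CJ d a * ((L : ℝ)⁻¹) ^ k := by
  have hL1 : 1 ≤ L := Nat.pos_of_ne_zero (NeZero.ne L)
  have hP := opNorm_calG_sub_planted_le (lev L k) L M a ha (one_le_lev' L k) hL1 (one_le_lev' L (k + 1))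
  rw [cast_lev', div_eq_mul_inv, ← inv_pow] at hP
  -- the planted law, read at the tower's names (`JK (n_k) L = J_k`, `calG (L·n_k) = 𝒢_{k+1}`, definitionally)
  have hP' : ‖calGsucc L M a ha k - Jpc L M k * calGlev L M a ha k * (Jpc L M k)ᴴ‖ ≤ CJ d a * ((L : ℝ)⁻¹) ^ k := hP
  -- `Jᴴ (𝒢′ − J𝒢Jᴴ) J = Jᴴ𝒢′J − 𝒢`
  have hJJ : (Jpc L M k)ᴴ * Jpc L M k = 1 := Jpc_conjTranspose_mul_Jpc L M k
  have e2 : (Jpc L M k)ᴴ * (Jpc L M k * calGlev L M a ha k * (Jpc L M k)ᴴ) * Jpc L M k = calGlev L M a ha k := by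
    calc (Jpc L M k)ᴴ * (Jpc L M k * calGlev L M a ha k * (Jpc L M k)ᴴ) * Jpc L M k
        = ((Jpc L M k)ᴴ * Jpc L M k) * calGlev L M a ha k * ((Jpc L M k)ᴴ * Jpc L M k) := by simp only [Matrix.mul_assoc]
      _ = calGlev L M a ha k := by rw [hJJ, Matrix.one_mul, Matrix.mul_one]
  have e : (Jpc L M k)ᴴ * calGsucc L M a ha k * Jpc L M k - calGlev L M a ha k
      = (Jpc L M k)ᴴ * (calGsucc L M a ha k - Jpc L M k * calGlev L M a ha k * (Jpc L M k)ᴴ) * Jpc L M k := by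
    rw [Matrix.mul_sub, Matrix.sub_mul, e2]
  rw [e]
  have hJ : ‖Jpc L M k‖ ≤ 1 := opNorm_Jpc_le L M k
  have hJt : ‖(Jpc L M k)ᴴ‖ ≤ 1 := by rw [Matrix.l2_opNorm_conjTranspose]; exact hJ
  have h0 : 0 ≤ CJ d a * ((L : ℝ)⁻¹) ^ k := (norm_nonneg _).trans hP'
  calc _ ≤ ‖(Jpc L M k)ᴴ * (calGsucc L M a ha k - Jpc L M k * calGlev L M a ha k * (Jpc L M k)ᴴ)‖ * ‖Jpc L M k‖ :=
        Matrix.l2_opNorm_mul _ _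
    _ ≤ (1 * (CJ d a * ((L : ℝ)⁻¹) ^ k)) * 1 := by
        refine mul_le_mul ?_ hJ (norm_nonneg _) (by positivity)
        exact (Matrix.l2_opNorm_mul _ _).trans (mul_le_mul hJt hP' (norm_nonneg _) zero_le_one)
    _ = CJ d a * ((L : ℝ)⁻¹) ^ k := by ring

/-- **triple-product entries**: `‖(Aᴴ·T·B) p r‖ ≤ ‖A‖·‖T‖·‖B‖` (the operator slot between two columns, DEMOTED: operator in operator norm,
columns in `ℓ²`). [folklore] -/
theorem norm_conjTranspose_mul_mul_apply_le {m k k' o : Type*} [Fintype m] [Fintype k] [Fintype k'] [Fintype o] [DecidableEq k]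
    [DecidableEq k'] [DecidableEq o] (A : Matrix m k ℂ) (T : Matrix m k' ℂ) (B : Matrix k' o ℂ) (p : k) (r : o) :
    ‖(Aᴴ * T * B) p r‖ ≤ ‖A‖ * ‖T‖ * ‖B‖ := by
  rw [Matrix.mul_assoc]
  calc ‖(Aᴴ * (T * B)) p r‖ ≤ ‖A‖ * ‖T * B‖ := norm_conjTranspose_mul_apply_le A (T * B) p r
    _ ≤ ‖A‖ * (‖T‖ * ‖B‖) := mul_le_mul_of_nonneg_left (Matrix.l2_opNorm_mul _ _) (norm_nonneg _)
    _ = ‖A‖ * ‖T‖ * ‖B‖ := (mul_assoc _ _ _).symm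

/-! ## §2 The chain «leg · 𝒢 · leg» and its three-slot Leibniz algebra -/

/-- **THE COVARIANCE CHAIN OF THE SOFT LEGS** `W^𝒢_k := M̃_kᴴ·𝒢_k·M̃_k` on the unit lattice: entries `⟨M̃_ke_p, 𝒢_kM̃_ke_r⟩`, i.e. the physical
`⟨u_p, 𝒢_k u_r⟩_{L²(T_η)}` for the soft legs `u = √(n_k^d)·M̃e`. [folklore] -/
def covChain (k : ℕ) : Matrix (idx L M 0) (idx L M 0) ℂ := (Mtil L M a ha k)ᴴ * calGlev L M a ha k * Mtil L M a ha k

/-- the same at the syntactic successor level (identity transport). [folklore] -/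
theorem covChain_succ (k : ℕ) :
    covChain L M a ha (k + 1)
      = (atSucc' L M k (Mtil L M a ha (k + 1)))ᴴ * calGsucc L M a ha k * atSucc' L M k (Mtil L M a ha (k + 1)) := rfl

/-- **LEIBNIZ (exact), operator slot in the sandwiched form**:
`M̃′ᴴ𝒢′M̃′ − M̃ᴴ𝒢M̃ = M̃′ᴴ𝒢′(M̃′ − JM̃) + (M̃′ − JM̃)ᴴ𝒢′(JM̃) + M̃ᴴ(Jᴴ𝒢′J − 𝒢)M̃`. [folklore] -/
theorem covChain_succ_sub_eq (k : ℕ) :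
    covChain L M a ha (k + 1) - covChain L M a ha k
      = (atSucc' L M k (Mtil L M a ha (k + 1)))ᴴ * calGsucc L M a ha k
            * (atSucc' L M k (Mtil L M a ha (k + 1)) - Jpc L M k * Mtil L M a ha k)
        + (atSucc' L M k (Mtil L M a ha (k + 1)) - Jpc L M k * Mtil L M a ha k)ᴴ * calGsucc L M a ha k
            * (Jpc L M k * Mtil L M a ha k)
        + (Mtil L M a ha k)ᴴ * ((Jpc L M k)ᴴ * calGsucc L M a ha k * Jpc L M k - calGlev L M a ha k) * Mtil L M a ha k := by
  rw [covChain_succ, covChain]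
  set M' := atSucc' L M k (Mtil L M a ha (k + 1))
  set Mk := Mtil L M a ha k
  set J := Jpc L M k
  set G' := calGsucc L M a ha k
  set G := calGlev L M a ha k
  have hJM : (J * Mk)ᴴ * G' * (J * Mk) = Mkᴴ * (Jᴴ * G' * J) * Mk := by
    rw [Matrix.conjTranspose_mul]
    simp only [Matrix.mul_assoc]
  rw [Matrix.mul_sub, Matrix.conjTranspose_sub, Matrix.sub_mul, Matrix.sub_mul, Matrix.mul_sub, Matrix.sub_mul, ← hJM]
  abel

/-! ## §3 The unconditional one-step sup rate of the covariance chain -/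

/-- **THE «leg · 𝒢 · leg» CHAIN IS ENTRYWISE CAUCHY AT RATE `L^{−k}`, UNCONDITIONALLY**: for all unit sites∕components `p r`, every `k`,
`‖W^𝒢_{k+1}(p,r) − W^𝒢_k(p,r)‖ ≤ (2·(a·Cst)·Cst·(a·CQH) + (a·Cst)²·CJ)·L^{−k}` — legs in `ℓ²`, the operator slot in operator norm via
King's pairing; no sup letter, no sup-norm rate, no sub-averaging. [folklore] -/
theorem norm_covChain_succ_sub_le (k : ℕ) (p r : idx L M 0) :
    ‖(covChain L M a ha (k + 1) - covChain L M a ha k) p r‖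
      ≤ (2 * ((a * Cst d a) * Cst d a * (a * CQH d a)) + (a * Cst d a) * (a * Cst d a) * CJ d a) * ((L : ℝ)⁻¹) ^ k := by
  have hA' : ‖atSucc' L M k (Mtil L M a ha (k + 1))‖ ≤ a * Cst d a := opNorm_Mtil_le L M a ha (k + 1)
  have hA : ‖Mtil L M a ha k‖ ≤ a * Cst d a := opNorm_Mtil_le L M a ha k
  have hG' : ‖calGsucc L M a ha k‖ ≤ Cst d a := opNorm_calGsucc_le L M a ha k
  have hD : ‖atSucc' L M k (Mtil L M a ha (k + 1)) - Jpc L M k * Mtil L M a ha k‖ ≤ a * CQH d a * ((L : ℝ)⁻¹) ^ k :=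
    opNorm_Mtil_succ_sub_le L M a ha k
  have hJM : ‖Jpc L M k * Mtil L M a ha k‖ ≤ a * Cst d a :=
    (Matrix.l2_opNorm_mul _ _).trans ((mul_le_mul (opNorm_Jpc_le L M k) hA (norm_nonneg _) zero_le_one).trans
      (le_of_eq (one_mul _)))
  have hS := opNorm_sandwich_calG_sub_le L M a ha k
  have hCst := Cst_nonneg d a
  have hε : 0 ≤ a * CQH d a * ((L : ℝ)⁻¹) ^ k := (norm_nonneg _).trans hD
  have hσ : 0 ≤ CJ d a * ((L : ℝ)⁻¹) ^ k := (norm_nonneg _).trans hS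
  have haC : 0 ≤ a * Cst d a := mul_nonneg ha.le hCst
  rw [covChain_succ_sub_eq, Matrix.add_apply, Matrix.add_apply]
  -- slot 1: `M̃′ᴴ 𝒢′ (M̃′ − JM̃)`
  have t1 : ‖((atSucc' L M k (Mtil L M a ha (k + 1)))ᴴ * calGsucc L M a ha k
      * (atSucc' L M k (Mtil L M a ha (k + 1)) - Jpc L M k * Mtil L M a ha k)) p r‖
        ≤ (a * Cst d a) * Cst d a * (a * CQH d a * ((L : ℝ)⁻¹) ^ k) :=
    (norm_conjTranspose_mul_mul_apply_le _ _ _ p r).trans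
      (mul_le_mul (mul_le_mul hA' hG' (norm_nonneg _) haC) hD (norm_nonneg _) (mul_nonneg haC hCst))
  -- slot 2: `(M̃′ − JM̃)ᴴ 𝒢′ (JM̃)`
  have t2 : ‖((atSucc' L M k (Mtil L M a ha (k + 1)) - Jpc L M k * Mtil L M a ha k)ᴴ * calGsucc L M a ha k
      * (Jpc L M k * Mtil L M a ha k)) p r‖ ≤ (a * CQH d a * ((L : ℝ)⁻¹) ^ k) * Cst d a * (a * Cst d a) :=
    (norm_conjTranspose_mul_mul_apply_le _ _ _ p r).trans
      (mul_le_mul (mul_le_mul hD hG' (norm_nonneg _) hε) hJM (norm_nonneg _) (mul_nonneg hε hCst))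
  -- slot 3: `M̃ᴴ (Jᴴ𝒢′J − 𝒢) M̃`
  have t3 : ‖((Mtil L M a ha k)ᴴ * ((Jpc L M k)ᴴ * calGsucc L M a ha k * Jpc L M k - calGlev L M a ha k)
      * Mtil L M a ha k) p r‖ ≤ (a * Cst d a) * (CJ d a * ((L : ℝ)⁻¹) ^ k) * (a * Cst d a) :=
    (norm_conjTranspose_mul_mul_apply_le _ _ _ p r).trans
      (mul_le_mul (mul_le_mul hA hS (norm_nonneg _) haC) hA (norm_nonneg _) (mul_nonneg haC hσ))
  calc _ ≤ ‖((atSucc' L M k (Mtil L M a ha (k + 1)))ᴴ * calGsucc L M a ha k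
              * (atSucc' L M k (Mtil L M a ha (k + 1)) - Jpc L M k * Mtil L M a ha k)) p r
            + ((atSucc' L M k (Mtil L M a ha (k + 1)) - Jpc L M k * Mtil L M a ha k)ᴴ * calGsucc L M a ha k
              * (Jpc L M k * Mtil L M a ha k)) p r‖
          + ‖((Mtil L M a ha k)ᴴ * ((Jpc L M k)ᴴ * calGsucc L M a ha k * Jpc L M k - calGlev L M a ha k)
              * Mtil L M a ha k) p r‖ := norm_add_le _ _
    _ ≤ (‖((atSucc' L M k (Mtil L M a ha (k + 1)))ᴴ * calGsucc L M a ha k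
              * (atSucc' L M k (Mtil L M a ha (k + 1)) - Jpc L M k * Mtil L M a ha k)) p r‖
            + ‖((atSucc' L M k (Mtil L M a ha (k + 1)) - Jpc L M k * Mtil L M a ha k)ᴴ * calGsucc L M a ha k
              * (Jpc L M k * Mtil L M a ha k)) p r‖)
          + ‖((Mtil L M a ha k)ᴴ * ((Jpc L M k)ᴴ * calGsucc L M a ha k * Jpc L M k - calGlev L M a ha k)
              * Mtil L M a ha k) p r‖ := by gcongr; exact norm_add_le _ _
    _ ≤ ((a * Cst d a) * Cst d a * (a * CQH d a * ((L : ℝ)⁻¹) ^ k)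
            + (a * CQH d a * ((L : ℝ)⁻¹) ^ k) * Cst d a * (a * Cst d a))
          + (a * Cst d a) * (CJ d a * ((L : ℝ)⁻¹) ^ k) * (a * Cst d a) := add_le_add (add_le_add t1 t2) t3
    _ = (2 * ((a * Cst d a) * Cst d a * (a * CQH d a)) + (a * Cst d a) * (a * Cst d a) * CJ d a) * ((L : ℝ)⁻¹) ^ k := by
        ring

end Summit.QuantumFields.BalabanUV.Beta.GAN24.SoftColumnCovarianceChain

end
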